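import Summits.Parity.BatemanHorn.Theorems.SelbergDelangeRigidityLSDRealSegmentTailsTwoTopPrep
import HarnessLib

/-!
# Route `SelbergDelangeRigidity`, crux `LSDRealSegment` (stmt-Parity-9770), line
# `product-anatomy-subcritical`: side conditions and numerology of clause (c) of `stub_tailsTwo`

The eventual side conditions in `x` of the top-class bound (after `η` is fixed) and the numerology of the choice
`η = η(ε)`: `η^y (1 + C (log(2/η) + 1)) ≤ (1 + 4C) √η` (`tailsTwo_eta_bound`, registered helper).
-/

open Filter Finset Polynomial
open scoped BigOperators Topology Classical

namespace Summit.Parity.BatemanHorn.Cruxes.LSDRealSegment.ProductAnatomySubcritical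

open Literature.NumberTheory.Sieve
open ArithmeticFunction (cardFactors)
noncomputable section

/-- Eventually in `x`: the side conditions of clause (c). [folklore] -/
theorem top_eventually (X₀ : ℕ) {η θhalf : ℝ} (L₁ L₂ Pr A B : ℝ) (hη : 0 < η) (hη2 : η < 1 / 2) (hθ : 0 < θhalf) :
    ∀ᶠ x : ℕ in atTop, (X₀ : ℝ) + 2 ≤ (x : ℝ) ^ (1 / 2 : ℝ) ∧ 8 ≤ x ∧ L₁ ≤ η * Real.log x ∧
      L₂ ≤ (1 - 2 * η) * Real.log x ∧ Pr ≤ (x : ℝ) ^ η ∧ A ≤ (x : ℝ) ^ (1 / 2 : ℝ) ∧ A ≤ x ∧ B ≤ (x : ℝ) ^ θhalf := by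
  have h := fun (e : ℝ) (he : 0 < e) (c : ℝ) =>
    ((tendsto_rpow_atTop he).comp tendsto_natCast_atTop_atTop).eventually_ge_atTop c
  have hl := fun (c : ℝ) (hc : 0 < c) (L : ℝ) =>
    ((Real.tendsto_log_atTop.comp tendsto_natCast_atTop_atTop).const_mul_atTop hc).eventually_ge_atTop L
  filter_upwards [h (1 / 2) (by norm_num) ((X₀ : ℝ) + 2), eventually_ge_atTop 8, hl η hη L₁, hl (1 - 2 * η) (by linarith) L₂,
    h η hη Pr, h (1 / 2) (by norm_num) A, tendsto_natCast_atTop_atTop.eventually_ge_atTop A, h θhalf hθ B]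
    with x h1 h2 h3 h4 h5 h6 h7 h8
  exact ⟨h1, h2, h3, h4, h5, h6, h7, h8⟩

/-- **tailsTwo_eta_bound** (registered helper of `stub_tailsTwo`, line `product-anatomy-subcritical`): the numerology of
the choice `η = η(ε)` in clause (c): `η^y (1 + C(log(2/η) + 1)) ≤ (1 + 4C) √η` for `0 < η ≤ 1 ≤ y` (`log t ≤ 2√t`). [folklore] -/
theorem tailsTwo_eta_bound : ∀ (η y C : ℝ), 0 < η → η ≤ 1 → 1 ≤ y → 0 ≤ C →
    η ^ y * (1 + C * (Real.log (2 / η) + 1)) ≤ (1 + 4 * C) * η ^ (1 / 2 : ℝ) := by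
  intro η y C hη hη1 hy hC
  have h1 : η ^ y ≤ η := by
    have := Real.rpow_le_rpow_of_exponent_ge hη hη1 hy
    rwa [Real.rpow_one] at this
  have hs : η ^ (1 / 2 : ℝ) * η ^ (1 / 2 : ℝ) = η := by rw [← Real.rpow_add hη]; norm_num
  have hs0 : 0 < η ^ (1 / 2 : ℝ) := Real.rpow_pos_of_pos hη _
  have hs1 : η ^ (1 / 2 : ℝ) ≤ 1 := Real.rpow_le_one hη.le hη1 (by norm_num)
  have hηs : η ≤ η ^ (1 / 2 : ℝ) := by nlinarith
  have hlog : Real.log (2 / η) ≤ 2 * (2 / η) ^ (1 / 2 : ℝ) := by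
    have := Real.log_le_rpow_div (show (0 : ℝ) ≤ 2 / η by positivity) (show (0 : ℝ) < 1 / 2 by norm_num)
    linarith [show (2 / η) ^ (1 / 2 : ℝ) / (1 / 2) = 2 * (2 / η) ^ (1 / 2 : ℝ) by ring]
  have h2 : η * (2 / η) ^ (1 / 2 : ℝ) = 2 ^ (1 / 2 : ℝ) * η ^ (1 / 2 : ℝ) := by
    rw [Real.div_rpow zero_le_two hη.le]
    field_simp
    nlinarith [hs]
  have h22 : (2 : ℝ) ^ (1 / 2 : ℝ) ≤ 3 / 2 := by
    have h4 : ((3 / 2 : ℝ) ^ 2) ^ (1 / 2 : ℝ) = 3 / 2 := by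
      rw [show (1 / 2 : ℝ) = ((2 : ℕ) : ℝ)⁻¹ by norm_num]; exact Real.pow_rpow_inv_natCast (by norm_num) two_ne_zero
    rw [← h4]; exact Real.rpow_le_rpow zero_le_two (by norm_num) (by norm_num)
  have hlog0 : 0 ≤ Real.log (2 / η) := Real.log_nonneg (by rw [le_div_iff₀ hη]; linarith)
  calc η ^ y * (1 + C * (Real.log (2 / η) + 1)) ≤ η * (1 + C * (Real.log (2 / η) + 1)) :=
        mul_le_mul_of_nonneg_right h1 (by positivity)
    _ = η + C * (η * Real.log (2 / η)) + C * η := by ring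
    _ ≤ η ^ (1 / 2 : ℝ) + C * (η * (2 * (2 / η) ^ (1 / 2 : ℝ))) + C * η ^ (1 / 2 : ℝ) := by
        gcongr
    _ = η ^ (1 / 2 : ℝ) + 2 * C * (2 ^ (1 / 2 : ℝ) * η ^ (1 / 2 : ℝ)) + C * η ^ (1 / 2 : ℝ) := by rw [← h2]; ring
    _ ≤ η ^ (1 / 2 : ℝ) + 2 * C * (3 / 2 * η ^ (1 / 2 : ℝ)) + C * η ^ (1 / 2 : ℝ) := by gcongr
    _ = (1 + 4 * C) * η ^ (1 / 2 : ℝ) := by ring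

end

end Summit.Parity.BatemanHorn.Cruxes.LSDRealSegment.ProductAnatomySubcritical
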